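/-
Copyright (c) 2026 the pub-hodgecm-mathlib formalisation cell (harness21).  Prover seat hodgecm-mathlib-K2E3-p14 (g4) ((SC-an) line lead), HCML Track B «K2-LIT»
(build stream 29), h413 = `stmt-HodgeConjecture-24833`, line `K2_E3_EllipticInputs`, unit U12 «Characters», socket #11 road (11-SC), letter (SC-an), road «FC»
(FINITE CONJUGATION MEASURE, RULINGS #15 ∕ MAP v5, `K2/STATUS.md` 2026-09-04T03:42:59Z), brick (FC-6b) FILE 2 OF 2 «A NEAR-LOWER-TRIANGULAR UNITARY ELEMENT WHOSE
SPLIT EIGENVALUES SIT NEAR A SEPARATED DIAGONAL HAS A NON-COMPACT CENTRALISER».  2026-09-04.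
-/
import Summits.HodgeConjecture.HodgeConjecture.Theorems.K2E3UnitaryAdjointIdempotent     -- FILE 1 (this seat, p857185): `adj_*`, Lagrange idempotent `e₀`, `f = e₀⋆`, `A f = σ(λ₀)⁻¹ f`, `e₀ f = f e₀ = 0`
import Literature.NumberTheory.Automorphic.UnitaryGroupBorelPair                -- ★ `mem_unitaryGroupOfForm_antidiagonal_iff_sum'`; brings ★ `unitaryGroupOfForm`, `StdForm.over_mul_over`
import Literature.NumberTheory.Automorphic.ValuedFieldValuativeRelBridge         -- ★ `v_le_iff_valuation_le` (the `Valued.v` ∕ `valuation` dictionary)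
import Literature.NumberTheory.Automorphic.AddCharConductorExponent              -- ★ `normAbs_le_normAbs_iff`, `normAbs_add_le_max`, `one_lt_residueFieldCard_nnreal`; brings ★ `normAbs`
import Literature.NumberTheory.Automorphic.TateLocalZetaShells                   -- ★ `exists_normAbs_eq_inv` (a uniformiser in `normAbs` currency)
import Literature.NumberTheory.Automorphic.LocalFieldHaarBalls                   -- ★ `continuous_normAbs`, `normAbs_add_eq_of_lt`
import HarnessLib

/-!
# h413 ∕ Track B «K2-LIT», road «FC» (finite conjugation measure), brick (FC-6b) FILE 2: A UNITARY `g ∈ U(σ, Φ₃)(K)` WHOSE CHARACTERISTIC POLYNOMIAL SPLITS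
# WITH ROOTS NEAR A SEPARATED, NEAR-LOWER-TRIANGULAR DIAGONAL HAS A NON-COMPACT CENTRALISER

Cell `pub/hodgecm-mathlib`, crux H413 = `stmt-HodgeConjecture-24833`, route of record `HCCMUnconditional`; lane `--supports stmt-HodgeConjecture-24833 --as helper`
(count-neutral).  THEOREMS ONLY (no `def`, no `instance`, no `notation`, no named-fact hypothesis, no `sorry`).  Dealer K2E3-plan (g3); (SC-an) line lead K2E3-p14 (g4)
(RULINGS #15–#18, `K2/STATUS.md` 2026-09-04T03:42–03:55Z).

THE ROAD «FC» AND THIS BRICK.  The (SC-an) consumer ★ p856355 needs on the elliptic set only an `L¹_loc` majorant of `g ↦ ∫‖θ(xgx⁻¹)‖dx` (★ p857163 (M5h‴) makes this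
«ELL-WEIGHT» the one remaining letter); road FC proves it by Tonelli in `x`, the Cartan cover `U = ⋃_d K₀ t_d K₀` (★ `K2E3WittCartan`), a coset count (★ p857173), averaging
(★ p857149), digit-count fibre bounds (FC-D), and the present statement: an element of the box `Ω_M ∩ t_d⁻¹Ω_M t_d` (upper entries of depth `d`) with COMPACT centraliser
has two `exp(−k)`-close diagonal entries (FC-8, K2E3-p23 (g4), consumes the contrapositive head below).  (FC-6a) `K2E3NearTriangularEigenvalues` (K2E5-p01 (g4)) supplies the
three `K`-rational eigenvalues near a SEPARATED diagonal; FILE 1 (★-to-be p857185) is the algebra engine.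

THE MATHEMATICS ([Rogawski1990, §1.9–§1.10, §3.5–§3.6]; [PlatonovRapinchuk1994, §3.3]).  `A = ↑g`, `A⋆ = J ᵗ(σA) J`, `e₀ = L₀(A)`, `f = e₀⋆` as in FILE 1.
§3 VALUATIONS: membership `ᵗ(σA) Φ₃ A = Φ₃` read at the entry `(2,0)` gives `σ(g₂₂)g₀₀ − 1 = −(σ(g₀₂)g₂₀ + σ(g₁₂)g₁₀)`, of valuation `≤ exp(2M − d)` on the box; if the
eigenvalue `λ₀` with `v(λ₀ − g₀₀) ≤ exp(3M + 2k − d)` were FIXED by the root involution (`σ(λ₀)λ₀ = 1`), the identity `(σλ₀ − σg₂₂)g₀₀ = (1 − σ(g₂₂)g₀₀) − σ(λ₀)(λ₀ − g₀₀)`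
would force `v(g₀₀ − g₂₂) ≤ exp(5M + 2k − d) < exp(−k)`, contradicting the separation.  §4: so the involution MOVES `λ₀`, FILE 1 gives `e₀ f = f e₀ = 0`, and
`y_a := 1 + (a − 1)e₀ + (σ(a)⁻¹ − 1)f` (`a ∈ K^×`) satisfies `y_a⋆ y_a = 1` and commutes with `A`: an element of `Z_U(g)` whose `(i,j)` entry (where `(e₀)_{ij} ≠ 0`) has
`‖·‖ = ‖a‖·‖(e₀)_{ij}‖` for `‖a‖` large — unbounded, so `Z_U(g)` is not compact (`g ↦ ‖g_{ij}‖` is continuous).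

* §3 `v_sigma_mul_sub_one_le` (unitarity near the Borel), `sigma_mul_ne_one_of_near_separated` (the involution moves `λ₀`);
* §4 `adj_y_mul_y_eq_one` (`y_a⋆ y_a = 1`), **`not_isCompact_centralizer_of_sigma_mul_ne_one`**, and the contrapositive head FC-8 consumes:
  **`exists_v_sub_lt_of_isCompact_centralizer_of_eigenvalues`** (eigenvalue form; ED. 2 composes it with ★ (FC-6a) `K2E3NearTriangularEigenvalues` once that lands).

HONEST LABEL.  HC_CM is proved only modulo the 7 printed citations (2 remaining named inputs: hLiu418 = `stmt-HodgeConjecture-24832`, h413 = `stmt-HodgeConjecture-24833`)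
until rung 0 closes; this file is a count-neutral helper of road FC ((SC-an) is NOT ★: ★ modulo «ELL-WEIGHT at the place», ★ p857163).

## References
* [Rogawski1990] J. D. Rogawski, *Automorphic Representations of Unitary Groups in Three Variables*, Ann. of Math. Stud. 123 (1990), §1.9–§1.10 p. 9, §3.5 p. 29, §3.6 pp. 31–32.
* [PlatonovRapinchuk1994] V. Platonov, A. Rapinchuk, *Algebraic Groups and Number Theory* (1994), §3.3 (anisotropic tori over local fields have compact points; split ones do not).
* [HarishChandra1970] Harish-Chandra (notes by G. van Dijk), *Harmonic Analysis on Reductive p-adic Groups*, LNM 162 (1970), Part VII §3 pp. 70–73 (the consumer).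
-/

set_option autoImplicit false
-- the mandated namespace repeats the single-problem summit's segment (`HodgeConjecture.HodgeConjecture`)
set_option linter.dupNamespace false

noncomputable section

open Matrix Polynomial
open scoped MatrixGroups NNReal WithZero
open Literature.NumberTheory.Automorphic Literature.NumberTheory.Automorphic.UnitaryGroup
open Literature.NumberTheory.GaloisRepresentations Literature.NumberTheory.GaloisRepresentations.IsNonarchimedeanLocalField
open Summit.HodgeConjecture.HodgeConjecture.Cruxes.H413.K2E3UnitaryAdjointIdempotent

namespace Summit.HodgeConjecture.HodgeConjecture.Cruxes.H413.K2E3NearSingularOfCompactCentralizer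

/-! ## §3 Valuations: unitarity near the Borel, and the root involution moves `λ₀` -/

section Valuations

variable {K : Type*} [Field K] [Valued K ℤᵐ⁰] (σ : K →+* K)

/-- **Unitarity read at the entry `(2,0)` of `ᵗ(σg) Φ₃ g = Φ₃`**: `σ(g₂₂) g₀₀ − 1 = −(σ(g₀₂) g₂₀ + σ(g₁₂) g₁₀)`, so on the box (all entries `≤ exp M`, `g₁₂` of depth `d`,
`g₀₂` of depth `2d`) `v(σ(g₂₂) g₀₀ − 1) ≤ exp(2M − d)`. [cite: Rogawski1990, §1.9–§1.10 p. 9] -/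
theorem v_sigma_mul_sub_one_le (hσv : ∀ x, Valued.v (σ x) = Valued.v x) {g : GL (Fin 3) K} (hg : g ∈ unitaryGroupOfForm σ ((StdForm.antidiagonal 3).over K)) {M d : ℕ}
    (hall : ∀ i j, Valued.v ((g : Matrix (Fin 3) (Fin 3) K) i j) ≤ WithZero.exp (M : ℤ))
    (h12 : Valued.v ((g : Matrix (Fin 3) (Fin 3) K) 1 2) ≤ WithZero.exp ((M : ℤ) - d))
    (h02 : Valued.v ((g : Matrix (Fin 3) (Fin 3) K) 0 2) ≤ WithZero.exp ((M : ℤ) - 2 * d)) :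
    Valued.v (σ ((g : Matrix (Fin 3) (Fin 3) K) 2 2) * (g : Matrix (Fin 3) (Fin 3) K) 0 0 - 1) ≤ WithZero.exp (2 * (M : ℤ) - d) := by
  have h := (mem_unitaryGroupOfForm_antidiagonal_iff_sum' σ 3 g).1 hg 2 0
  rw [Fin.sum_univ_three, if_pos (by decide)] at h
  -- `h : σ(g₀₂) g₂₀ + σ(g₁₂) g₁₀ + σ(g₂₂) g₀₀ = 1` (`rev 0 = 2`, `rev 1 = 1`, `rev 2 = 0`)
  have hrev0 : (Fin.rev 0 : Fin 3) = 2 := by decide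
  have hrev1 : (Fin.rev 1 : Fin 3) = 1 := by decide
  have hrev2 : (Fin.rev 2 : Fin 3) = 0 := by decide
  rw [hrev0, hrev1, hrev2] at h
  have hid : σ ((g : Matrix (Fin 3) (Fin 3) K) 2 2) * (g : Matrix (Fin 3) (Fin 3) K) 0 0 - 1 =
      -(σ ((g : Matrix (Fin 3) (Fin 3) K) 0 2) * (g : Matrix (Fin 3) (Fin 3) K) 2 0 + σ ((g : Matrix (Fin 3) (Fin 3) K) 1 2) * (g : Matrix (Fin 3) (Fin 3) K) 1 0) := by
    rw [← h]; ring
  rw [hid, Valuation.map_neg]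
  refine (Valuation.map_add _ _ _).trans (max_le ?_ ?_)
  · rw [map_mul, hσv, show (2 * (M : ℤ) - d) = ((M : ℤ) - 2 * d) + ((M : ℤ) + d) by ring, WithZero.exp_add]
    refine mul_le_mul' h02 ((hall 2 0).trans ?_)
    rw [WithZero.exp_le_exp]; omega
  · rw [map_mul, hσv, show (2 * (M : ℤ) - d) = ((M : ℤ) - d) + (M : ℤ) by ring, WithZero.exp_add]
    exact mul_le_mul' h12 (hall 1 0)

/-- **The root involution moves `λ₀`**: if `v(λ₀ − g₀₀) ≤ exp(3M + 2k − d)`, `v(σ(g₂₂)g₀₀ − 1) ≤ exp(2M − d)`, `v(g₀₀), v(g₂₂) ≤ exp M`, the diagonal is separated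
(`exp(−k) ≤ v(g₀₀ − g₂₂)`) and `5M + 4k + 2 ≤ d`, then `σ(λ₀) λ₀ ≠ 1`. [cite: Rogawski1990, §3.5 p. 29, §3.6 pp. 31–32] -/
theorem sigma_mul_ne_one_of_near_separated (hσv : ∀ x, Valued.v (σ x) = Valued.v x) {g₀₀ g₂₂ lam₀ : K} {M k d : ℕ} (hd : 5 * M + 4 * k + 2 ≤ d)
    (h00 : Valued.v g₀₀ ≤ WithZero.exp (M : ℤ)) (h22 : Valued.v g₂₂ ≤ WithZero.exp (M : ℤ))
    (hU : Valued.v (σ g₂₂ * g₀₀ - 1) ≤ WithZero.exp (2 * (M : ℤ) - d))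
    (hlam : Valued.v (lam₀ - g₀₀) ≤ WithZero.exp (3 * (M : ℤ) + 2 * k - d))
    (hsep : WithZero.exp (-(k : ℤ)) ≤ Valued.v (g₀₀ - g₂₂)) :
    σ lam₀ * lam₀ ≠ 1 := by
  intro h1
  -- `σ(g₂₂) g₀₀` is a unit of valuation `1`, hence `v(g₀₀) ≥ exp(−M)`
  have hlt1 : WithZero.exp (2 * (M : ℤ) - d) < 1 := by
    rw [← WithZero.exp_zero, WithZero.exp_lt_exp]; omega
  have hunit : Valued.v (σ g₂₂ * g₀₀) = 1 := by
    have h := Valuation.map_eq_of_sub_lt Valued.v (x := (1 : K)) (y := σ g₂₂ * g₀₀) (by rw [Valuation.map_one]; exact hU.trans_lt hlt1)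
    rwa [Valuation.map_one] at h
  have hg00 : g₀₀ ≠ 0 := by
    intro h0; rw [h0, mul_zero, Valuation.map_zero] at hunit; exact zero_ne_one hunit
  have hv00 : WithZero.exp (-(M : ℤ)) ≤ Valued.v g₀₀ := by
    rw [map_mul, hσv] at hunit
    have hne : Valued.v g₂₂ ≠ 0 := fun h0 => by rw [h0, zero_mul] at hunit; exact zero_ne_one hunit
    have : Valued.v g₀₀ = (Valued.v g₂₂)⁻¹ := eq_inv_of_mul_eq_one_right hunit
    rw [this, WithZero.exp_neg]
    exact inv_anti₀ (zero_lt_iff.2 hne) h22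
  -- the key identity
  have hid : (σ lam₀ - σ g₂₂) * g₀₀ = (1 - σ g₂₂ * g₀₀) - σ lam₀ * (lam₀ - g₀₀) := by
    have : σ lam₀ * lam₀ = 1 := h1
    linear_combination this
  have hvlam : Valued.v lam₀ ≤ WithZero.exp (M : ℤ) := by
    have h := Valuation.map_add Valued.v (lam₀ - g₀₀) g₀₀
    rw [sub_add_cancel] at h
    refine h.trans (max_le (hlam.trans ?_) h00)
    rw [WithZero.exp_le_exp]; omega
  have hkey : Valued.v ((σ lam₀ - σ g₂₂) * g₀₀) ≤ WithZero.exp (4 * (M : ℤ) + 2 * k - d) := by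
    rw [hid]
    refine (Valuation.map_sub _ _ _).trans (max_le ?_ ?_)
    · rw [← Valuation.map_neg, neg_sub]
      refine hU.trans ?_
      rw [WithZero.exp_le_exp]; omega
    · rw [map_mul, hσv, show (4 * (M : ℤ) + 2 * k - d) = (M : ℤ) + (3 * (M : ℤ) + 2 * k - d) by ring, WithZero.exp_add]
      exact mul_le_mul' hvlam hlam
  -- divide by `v(g₀₀) ≥ exp(−M)`
  have hdiff : Valued.v (lam₀ - g₂₂) ≤ WithZero.exp (5 * (M : ℤ) + 2 * k - d) := by
    have h2 : Valued.v (σ lam₀ - σ g₂₂) * WithZero.exp (-(M : ℤ)) ≤ WithZero.exp (4 * (M : ℤ) + 2 * k - d) := by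
      refine le_trans ?_ hkey
      rw [map_mul]
      exact mul_le_mul' le_rfl hv00
    rw [← map_sub, hσv] at h2
    have h3 : Valued.v (lam₀ - g₂₂) ≤ WithZero.exp (4 * (M : ℤ) + 2 * k - d) * (WithZero.exp (-(M : ℤ)))⁻¹ :=
      (le_mul_inv_iff₀ (WithZero.exp_pos)).2 h2
    rw [← WithZero.exp_neg, neg_neg, ← WithZero.exp_add] at h3
    refine h3.trans ?_
    rw [WithZero.exp_le_exp]; omega
  have hfin : Valued.v (g₀₀ - g₂₂) ≤ WithZero.exp (5 * (M : ℤ) + 2 * k - d) := by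
    have h := Valuation.map_add Valued.v (g₀₀ - lam₀) (lam₀ - g₂₂)
    rw [sub_add_sub_cancel] at h
    refine h.trans (max_le ?_ hdiff)
    rw [← Valuation.map_neg, neg_sub]
    refine hlam.trans ?_
    rw [WithZero.exp_le_exp]; omega
  have hlt : WithZero.exp (5 * (M : ℤ) + 2 * k - d) < WithZero.exp (-(k : ℤ)) := by
    rw [WithZero.exp_lt_exp]; omega
  exact absurd (hsep.trans hfin) (not_le.2 hlt)

end Valuations

/-! ## §4 The split torus through `e₀` and `f`: `y_a ∈ Z_U(g)` is unbounded -/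

section Torus

variable {K : Type*} [Field K] (σ : K →+* K) (hσ : ∀ x, σ (σ x) = x) (S : StdForm 3)

/-- **`y_a⋆ y_a = 1`** for `y_a = 1 + (a − 1) e + (b − 1) f` with `σ(b) a = 1`, `σ(a) b = 1`, whenever `e, f` are idempotents with `e f = f e = 0` and `e⋆ = f`, `f⋆ = e`
(`⋆ = J ᵗ(σ·) J`, `J = S.over K`). [cite: Rogawski1990, §3.6 pp. 31–32] -/
theorem adj_y_mul_y_eq_one {e f : Matrix (Fin 3) (Fin 3) K} (hee : e * e = e) (hff : f * f = f) (hef : e * f = 0) (hfe : f * e = 0)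
    (hestar : S.over K * (e.map σ)ᵀ * S.over K = f) (hfstar : S.over K * (f.map σ)ᵀ * S.over K = e) {a b : K} (hab : σ b * a = 1) (hba : σ a * b = 1) :
    S.over K * ((1 + (a - 1) • e + (b - 1) • f).map σ)ᵀ * S.over K * (1 + (a - 1) • e + (b - 1) • f) = 1 := by
  have hJJ : S.over K * S.over K = 1 := S.over_mul_over K
  have hstar : S.over K * ((1 + (a - 1) • e + (b - 1) • f).map σ)ᵀ * S.over K = 1 + (σ a - 1) • f + (σ b - 1) • e := by
    rw [adj_add σ, adj_add σ, adj_smul σ, adj_smul σ, adj_one σ hJJ, hestar, hfstar, map_sub, map_sub, map_one]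
  rw [hstar]
  -- expand with the relations
  have h1 : (1 + (σ a - 1) • f + (σ b - 1) • e) * (1 + (a - 1) • e + (b - 1) • f) =
      1 + ((a - 1) + (σ b - 1) + (σ b - 1) * (a - 1)) • e + ((b - 1) + (σ a - 1) + (σ a - 1) * (b - 1)) • f := by
    simp only [Matrix.add_mul, Matrix.mul_add, Matrix.one_mul, Matrix.mul_one, Matrix.smul_mul, Matrix.mul_smul, hee, hff, hef, hfe, smul_zero,
      add_zero]
    module
  rw [h1]
  have hcoe : (a - 1) + (σ b - 1) + (σ b - 1) * (a - 1) = 0 := by linear_combination hab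
  have hcof : (b - 1) + (σ a - 1) + (σ a - 1) * (b - 1) = 0 := by linear_combination hba
  rw [hcoe, hcof, zero_smul, zero_smul, add_zero, add_zero]

end Torus

section Head

variable {K : Type*} [Field K] [Valued K ℤᵐ⁰] [ValuativeRel K] [(Valued.v : Valuation K ℤᵐ⁰).Compatible] [IsNonarchimedeanLocalField K]
  (σ : K →+* K) (hσ : ∀ x, σ (σ x) = x) (hσv : ∀ x, Valued.v (σ x) = Valued.v x) (S : StdForm 3)

include hσ hσv in
/-- **A UNITARY `g ∈ U(σ, J)(K)` (`J` a standard form) WHOSE CHARACTERISTIC POLYNOMIAL SPLITS WITH DISTINCT ROOTS `λᵢ` SUCH THAT THE ROOT INVOLUTION MOVES `λ₀`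
(`σ(λ₀) λ₀ ≠ 1`) HAS A NON-COMPACT CENTRALISER**: the elements `y_a = 1 + (a−1)e₀ + (σ(a)⁻¹−1)e₀⋆`, `a ∈ K^×`, lie in `Z_U(g)` and have an unbounded entry.
[cite: Rogawski1990, §3.6 pp. 31–32] [cite: PlatonovRapinchuk1994, §3.3] -/
theorem not_isCompact_centralizer_of_sigma_mul_ne_one (g : ↥(unitaryGroupOfForm σ (S.over K))) {lam : Fin 3 → K}
    (hp : ((g : GL (Fin 3) K) : Matrix (Fin 3) (Fin 3) K).charpoly = ∏ i, (X - C (lam i))) (hinj : Function.Injective lam) (hne : σ (lam 0) * lam 0 ≠ 1) :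
    ¬ IsCompact ((Subgroup.centralizer ({g} : Set ↥(unitaryGroupOfForm σ (S.over K)))) : Set ↥(unitaryGroupOfForm σ (S.over K))) := by
  intro hZ
  obtain ⟨J, hJdef⟩ : ∃ J : Matrix (Fin 3) (Fin 3) K, S.over K = J := ⟨_, rfl⟩
  obtain ⟨A, hA⟩ : ∃ A : Matrix (Fin 3) (Fin 3) K, ((g : GL (Fin 3) K) : Matrix (Fin 3) (Fin 3) K) = A := ⟨_, rfl⟩
  have hJJ : J * J = 1 := by rw [← hJdef]; exact S.over_mul_over K
  have hJσ : J.map σ = J := by rw [← hJdef]; exact S.over_map σ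
  have hJT : Jᵀ = J := by rw [← hJdef]; exact S.transpose_over K
  have hmem : (A.map σ)ᵀ * J * A = J := by rw [← hJdef, ← hA]; exact g.2
  have hAu : J * (A.map σ)ᵀ * J * A = 1 := by
    rw [Matrix.mul_assoc J, Matrix.mul_assoc J, hmem, hJJ]
  rw [hA] at hp
  have hne' : (σ (lam 0))⁻¹ ≠ lam 0 := by
    intro h
    apply hne
    have h0 : σ (lam 0) ≠ 0 := (_root_.map_ne_zero σ).2 (lam_ne_zero σ hAu hp 0)
    calc σ (lam 0) * lam 0 = σ (lam 0) * (σ (lam 0))⁻¹ := by rw [h]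
      _ = 1 := mul_inv_cancel₀ h0
  -- the two idempotents
  obtain ⟨e, he⟩ : ∃ e : Matrix (Fin 3) (Fin 3) K, aeval A (C ((lam 0 - lam 1) * (lam 0 - lam 2))⁻¹ * ((X - C (lam 1)) * (X - C (lam 2)))) = e := ⟨_, rfl⟩
  obtain ⟨f, hf⟩ : ∃ f : Matrix (Fin 3) (Fin 3) K, J * (e.map σ)ᵀ * J = f := ⟨_, rfl⟩
  have hee : e * e = e := by have h := lagrange_mul_self hp hinj; rwa [he] at h
  have hff : f * f = f := by have h := adjLagrange_mul_self σ hJJ hp hinj; rwa [he, hf] at h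
  obtain ⟨hef, hfe⟩ : e * f = 0 ∧ f * e = 0 := by
    have h := lagrange_mul_adjLagrange_eq_zero σ hσ hJJ hJσ hJT hAu hp hinj hne'; rwa [he, hf] at h
  have hfstar : J * (f.map σ)ᵀ * J = e := by rw [← hf]; exact adj_adj σ hσ hJJ hJσ hJT e
  have heA : e * A = A * e := by rw [← he]; exact aeval_mul_self_comm _
  have hfA : A * f = f * A := by have h := (commute_adjLagrange σ hJJ hAu (lam := lam)).eq; rwa [he, hf] at h
  have he0 : e ≠ 0 := by have h := lagrange_ne_zero hp hinj; rwa [he] at h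
  -- a non-zero entry of `e`
  obtain ⟨i, j, hij⟩ : ∃ i j, e i j ≠ 0 := by
    by_contra h
    push Not at h
    exact he0 (Matrix.ext fun i j => h i j)
  -- the unitary elements `y_a`
  have hy : ∀ a : K, a ≠ 0 →
      ∃ y : ↥(unitaryGroupOfForm σ (S.over K)), y ∈ Subgroup.centralizer ({g} : Set ↥(unitaryGroupOfForm σ (S.over K))) ∧
        ((y : GL (Fin 3) K) : Matrix (Fin 3) (Fin 3) K) = 1 + (a - 1) • e + ((σ a)⁻¹ - 1) • f := by
    intro a ha
    have hσa : σ a ≠ 0 := (_root_.map_ne_zero σ).2 ha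
    set Y : Matrix (Fin 3) (Fin 3) K := 1 + (a - 1) • e + ((σ a)⁻¹ - 1) • f with hY
    have hYY : J * (Y.map σ)ᵀ * J * Y = 1 := by
      have h := adj_y_mul_y_eq_one σ S hee hff hef hfe (by rw [hJdef]; exact hf) (by rw [hJdef]; exact hfstar) (a := a) (b := (σ a)⁻¹)
        (by rw [map_inv₀, hσ, inv_mul_cancel₀ ha]) (by rw [mul_inv_cancel₀ hσa])
      rwa [hJdef] at h
    have hYY' : Y * (J * (Y.map σ)ᵀ * J) = 1 := mul_eq_one_comm.1 hYY
    let Yu : GL (Fin 3) K := ⟨Y, J * (Y.map σ)ᵀ * J, hYY', hYY⟩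
    have hYmem : Yu ∈ unitaryGroupOfForm σ (S.over K) := by
      show (Y.map σ)ᵀ * S.over K * Y = S.over K
      rw [hJdef]
      calc (Y.map σ)ᵀ * J * Y = J * J * ((Y.map σ)ᵀ * J * Y) := by rw [hJJ, Matrix.one_mul]
        _ = J * (J * (Y.map σ)ᵀ * J * Y) := by simp only [Matrix.mul_assoc]
        _ = J := by rw [hYY, Matrix.mul_one]
    refine ⟨⟨Yu, hYmem⟩, ?_, rfl⟩
    rw [Subgroup.mem_centralizer_iff]
    intro h hh
    rw [Set.mem_singleton_iff] at hh
    rw [hh]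
    apply Subtype.ext
    apply Units.ext
    show ((g : GL (Fin 3) K) : Matrix (Fin 3) (Fin 3) K) * Y = Y * ((g : GL (Fin 3) K) : Matrix (Fin 3) (Fin 3) K)
    rw [hA, hY, Matrix.mul_add, Matrix.mul_add, Matrix.add_mul, Matrix.add_mul, Matrix.mul_one, Matrix.one_mul, Matrix.mul_smul, Matrix.smul_mul, Matrix.mul_smul,
      Matrix.smul_mul, ← heA, hfA]
  -- `σ` is an isometry of `normAbs` (★ `K2E3SplitTorusTwistModuleBound.normAbs_map_eq`, re-derived from the two ★ dictionaries to keep the import light)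
  have normAbs_map_eq : ∀ x : K, normAbs K (σ x) = normAbs K x := fun x =>
    le_antisymm (by rw [normAbs_le_normAbs_iff, ← v_le_iff_valuation_le, hσv]) (by rw [normAbs_le_normAbs_iff, ← v_le_iff_valuation_le, hσv])
  -- the continuous entry functional is bounded on the compact centraliser
  have hcont : Continuous fun z : ↥(unitaryGroupOfForm σ (S.over K)) => normAbs K (((z : GL (Fin 3) K) : Matrix (Fin 3) (Fin 3) K) i j) :=
    LocalFieldHaar.continuous_normAbs.comp ((Units.continuous_val.comp continuous_subtype_val).matrix_elem i j)
  obtain ⟨B, hB⟩ := hZ.bddAbove_image hcont.continuousOn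
  -- the constant part of the entry and its size
  set c0 : K := (1 : Matrix (Fin 3) (Fin 3) K) i j - e i j - f i j with hc0
  obtain ⟨ϖ, hϖ0, hϖ⟩ := exists_normAbs_eq_inv (F := K)
  have hq : 1 < (residueFieldCard K : ℝ≥0) := one_lt_residueFieldCard_nnreal
  have hepos : 0 < normAbs K (e i j) := pos_iff_ne_zero.2 ((_root_.map_ne_zero _).2 hij)
  obtain ⟨n, hn⟩ := pow_unbounded_of_one_lt ((max B (max (normAbs K c0) (normAbs K (f i j)))) / normAbs K (e i j)) hq
  have hbig : max B (max (normAbs K c0) (normAbs K (f i j))) < (residueFieldCard K : ℝ≥0) ^ n * normAbs K (e i j) :=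
    (div_lt_iff₀ hepos).1 hn
  set a : K := (ϖ ^ n)⁻¹ with ha
  have hϖn : ϖ ^ n ≠ 0 := pow_ne_zero n hϖ0
  have ha0 : a ≠ 0 := inv_ne_zero hϖn
  have hna : normAbs K a = (residueFieldCard K : ℝ≥0) ^ n := by
    rw [ha, map_inv₀, map_pow, hϖ, inv_pow, inv_inv]
  obtain ⟨y, hyZ, hyval⟩ := hy a ha0
  -- the `(i,j)` entry of `y_a` is `c0 + a e_ij + σ(a)⁻¹ f_ij`, of absolute value `q^n ‖e_ij‖`
  have hentry : ((y : GL (Fin 3) K) : Matrix (Fin 3) (Fin 3) K) i j = a * e i j + (c0 + (σ a)⁻¹ * f i j) := by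
    rw [hyval, hc0]
    simp only [Matrix.add_apply, Matrix.smul_apply, smul_eq_mul]
    ring
  have hsmall : normAbs K (c0 + (σ a)⁻¹ * f i j) < normAbs K (a * e i j) := by
    refine (normAbs_add_le_max _ _).trans_lt (max_lt ?_ ?_)
    · rw [map_mul, hna]
      exact lt_of_le_of_lt (le_max_of_le_right (le_max_left _ _)) hbig
    · rw [map_mul, map_mul, hna, map_inv₀, normAbs_map_eq, hna]
      refine lt_of_le_of_lt ?_ hbig
      refine le_trans ?_ (le_max_of_le_right (le_max_right _ _))
      have h1 : ((residueFieldCard K : ℝ≥0) ^ n)⁻¹ ≤ 1 := inv_le_one_of_one_le₀ (one_le_pow₀ hq.le)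
      calc ((residueFieldCard K : ℝ≥0) ^ n)⁻¹ * normAbs K (f i j) ≤ 1 * normAbs K (f i j) := mul_le_mul' h1 le_rfl
        _ = normAbs K (f i j) := one_mul _
  have hval : normAbs K (((y : GL (Fin 3) K) : Matrix (Fin 3) (Fin 3) K) i j) = (residueFieldCard K : ℝ≥0) ^ n * normAbs K (e i j) := by
    rw [hentry, LocalFieldHaar.normAbs_add_eq_of_lt hsmall, map_mul, hna]
  have hle := hB ⟨y, hyZ, rfl⟩
  simp only [hval] at hle
  exact absurd (lt_of_le_of_lt (le_max_left _ _) hbig) (not_lt.2 hle)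

include hσ hσv in
/-- **THE HEAD OF (FC-6b), EIGENVALUE FORM.**  `g ∈ U(σ, Φ₃)(K)` in the box (all entries `≤ exp M`, `g₁₂` of depth `d`, `g₀₂` of depth `2d`), with COMPACT centraliser,
whose characteristic polynomial splits as `Π (X − λᵢ)` with `v(λᵢ − gᵢᵢ) ≤ exp(3M + 2k − d)` ((FC-6a) supplies such `λ` when the diagonal is `exp(−k)`-separated), and
`5M + 4k + 2 ≤ d`: then two diagonal entries are `exp(−k)`-CLOSE.  (Contrapositive of §3–§4: separated ⇒ `λ` injective ⇒ the root involution moves `λ₀` ⇒ `Z_U(g)` not compact.)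
[cite: Rogawski1990, §3.6 pp. 31–32] [cite: PlatonovRapinchuk1994, §3.3] -/
theorem exists_v_sub_lt_of_isCompact_centralizer_of_eigenvalues {J : Matrix (Fin 3) (Fin 3) K} (hJ : J = (StdForm.antidiagonal 3).over K) {M k d : ℕ}
    (hd : 5 * M + 4 * k + 2 ≤ d) (g : ↥(unitaryGroupOfForm σ J))
    (hall : ∀ i j, Valued.v (((g : GL (Fin 3) K) : Matrix (Fin 3) (Fin 3) K) i j) ≤ WithZero.exp (M : ℤ))
    (h12 : Valued.v (((g : GL (Fin 3) K) : Matrix (Fin 3) (Fin 3) K) 1 2) ≤ WithZero.exp ((M : ℤ) - d))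
    (h02 : Valued.v (((g : GL (Fin 3) K) : Matrix (Fin 3) (Fin 3) K) 0 2) ≤ WithZero.exp ((M : ℤ) - 2 * d))
    (hZ : IsCompact ((Subgroup.centralizer ({g} : Set ↥(unitaryGroupOfForm σ J))) : Set ↥(unitaryGroupOfForm σ J)))
    {lam : Fin 3 → K} (hp : (((g : GL (Fin 3) K) : Matrix (Fin 3) (Fin 3) K)).charpoly = ∏ i, (X - C (lam i)))
    (hlam : ∀ i, Valued.v (lam i - ((g : GL (Fin 3) K) : Matrix (Fin 3) (Fin 3) K) i i) ≤ WithZero.exp (3 * (M : ℤ) + 2 * k - d)) :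
    ∃ i j : Fin 3, i ≠ j ∧
      Valued.v (((g : GL (Fin 3) K) : Matrix (Fin 3) (Fin 3) K) i i - ((g : GL (Fin 3) K) : Matrix (Fin 3) (Fin 3) K) j j) < WithZero.exp (-(k : ℤ)) := by
  subst hJ
  by_contra hcon
  have hsep : ∀ i j : Fin 3, i ≠ j →
      WithZero.exp (-(k : ℤ)) ≤ Valued.v (((g : GL (Fin 3) K) : Matrix (Fin 3) (Fin 3) K) i i - ((g : GL (Fin 3) K) : Matrix (Fin 3) (Fin 3) K) j j) := by
    intro i j hij
    by_contra hlt
    exact hcon ⟨i, j, hij, not_le.1 hlt⟩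
  have hsmall : WithZero.exp (3 * (M : ℤ) + 2 * k - d) < WithZero.exp (-(k : ℤ)) := by
    rw [WithZero.exp_lt_exp]; omega
  -- the eigenvalues are pairwise distinct
  have hinj : Function.Injective lam := by
    intro i j hij
    by_contra hne
    have h := Valuation.map_add Valued.v (((g : GL (Fin 3) K) : Matrix (Fin 3) (Fin 3) K) i i - lam i) (lam j - ((g : GL (Fin 3) K) : Matrix (Fin 3) (Fin 3) K) j j)
    rw [hij, sub_add_sub_cancel] at h
    have h' : Valued.v (((g : GL (Fin 3) K) : Matrix (Fin 3) (Fin 3) K) i i - ((g : GL (Fin 3) K) : Matrix (Fin 3) (Fin 3) K) j j) < WithZero.exp (-(k : ℤ)) := by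
      refine h.trans_lt (max_lt ?_ ((hlam j).trans_lt hsmall))
      rw [← Valuation.map_neg, neg_sub, ← hij]
      exact (hlam i).trans_lt hsmall
    exact absurd (hsep i j hne) (not_le.2 h')
  -- unitarity near the Borel and the moving root
  have hU := v_sigma_mul_sub_one_le σ hσv g.2 hall h12 h02
  have hne : σ (lam 0) * lam 0 ≠ 1 :=
    sigma_mul_ne_one_of_near_separated σ hσv hd (hall 0 0) (hall 2 2) hU (hlam 0) (hsep 0 2 (by decide))
  exact not_isCompact_centralizer_of_sigma_mul_ne_one σ hσ hσv (StdForm.antidiagonal 3) g hp hinj hne hZ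

end Head



end Summit.HodgeConjecture.HodgeConjecture.Cruxes.H413.K2E3NearSingularOfCompactCentralizer

end
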